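import Summits.Parity.GeneralizedHardyLittlewood.Theorems.PrimeLevelFamEdgeMomentsBeyondDiagonalDiagPrimeCoupling
import Summits.Parity.GeneralizedHardyLittlewood.Theorems.PrimeLevelFamEdgeMomentsBeyondDiagonalDiagDecorPrime
import HarnessLib

/-!
# Route `PrimeLevelFamEdge`, crux K_A `MomentsBeyondDiagonal` (stmt-Parity-20007), line «petersson_layers» v4, stub `stub_diag`:
# **the prime-square decorated coprime Selberg sum, termwise layer: the prime-sum main part
# `Σ_{p≤y,p∤n}(log p/(p−1))·log p·log^{c−2}(y/p) = logᶜy/(c(c−1)) + O((19+κ(n))(1+log y)^{c−1})` and the per-prime bounds**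

Census R3(ii), ANALYTIC HALF, first decorated engine (the arithmetic input of rung `N = 1` = order `(1,1)` of the
exact remaining list `Cruxes/MomentsBeyondDiagonal/Lines/petersson_layers_stub_diag_g8_orders.md`). In the decorated
Selberg coordinates of `…DiagOrderSelberg` the `d ∣ k₁`, `e ∣ k₂` sums of the log-decorations are the generalised divisor
sums `τ_{α,β}(k) = Σ_{d∣k}(log d)^α(log(k/d))^β`; on squarefree `k` (`μ(cgk) ≠ 0`)
`τ_{1,1}(k) = τ(k)(log²k − P₂(k))/4` (`…DiagDecorMult.tau11_eq_of_squarefree`) and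
`τ_{2,0}(k) = τ(k)(log²k + P₂(k))/4` (`…DiagDecorTau2.tau20_eq_of_squarefree`) with the ADDITIVE prime-square sum
`P₂(k) = Σ_{p∣k} log²p`. By `…DiagDecorPrime.sum_copTauW_mul_mul_sum_primeFactors_eq` the `P₂`-decorated sum against the
Selberg weights `a_n(k) = copTauW n k = τ(k)W(k)[(k,n)=1]` is the PRIME SUM `Σ_{p≤y} log²p·a_n(p)·S⁽ᶜ⁾(y/p; np)` of
undecorated coprime sums `S⁽ᶜ⁾(z;m) = Σ_{k≤z} a_m(k)logᶜ(z/k)`. This file supplies the per-prime bookkeeping: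

* `abs_sum_primeWeight_log_mul_log_pow_sub_le` — **the prime-sum main part**
  `|Σ_{p≤y,p∤n}(log p/(p−1))·log p·log^{c−2}(y/p) − logᶜy/(c(c−1))| ≤ 2(19+κ(n))(1+log y)^{c−1}` (`c ≥ 2`;
  `log p = log y − log(y/p)` and `…DiagPrimeSum.abs_sum_primeWeight_coprime_mul_log_pow_sub_le` at orders `c−2`, `c−1`);
* `abs_primeSq_term_sub_le` (`c ≥ 3`) / `abs_primeSq_term_two_sub_le` (`c = 2`) — **per prime `p ≤ y`:
  `[p prime]·log²p·a_n(p)·S⁽ᶜ⁾(y/p;np) = −2c(c−1)E_n·[p∤n](log p/(p−1))·log p·log^{c−2}(y/p) + err_p`** with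
  `|err_p| ≤ [p∤n](log p/(p+1))·4C·D(n)(1+log y)^{c−3}log y` (resp. `≤ [p prime]log p/(p(1+log(y/p))²)·4C·D(n)log y`),
  from the inner engine `S⁽ᶜ⁾(y/p;np) = c(c−1)E_{np}log^{c−2}(y/p) + O(C·D(np)(1+log(y/p))^{c−3})`
  (`…DiagCoprime.abs_coprimeSumPow_sub_le`, resp. `KernelFormXSqCore.abs_coprimeSum_sub_le`), `a_n(p) = −2/(p+1)·[p∤n]`
  (`copTauW_apply_prime`), the prime weight transfer `(log p/(p+1))E_{np} = E_n·log p/(p−1)` (`log_div_succ_mul_mainConst_mul`)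
  and `D(np) ≤ 2D(n)` (`divWeight_prime_mul_le`);
* small facts: `sum_copTauW_mul_log_div_mul_pow_eq` (`⌊y⌋/p = ⌊y/p⌋`, `y/(pk) = (y/p)/k`), `prime_range_facts`.

The companion file `…DiagDecorPrimeSq` sums these over `p ≤ y`:
`Σ_{k≤y} a_n(k)logᶜ(y/k)P₂(k) = −2E_n logᶜy + O_c(D(n)(1+κ(n))(1+log y)^{c−1})`, `c ≥ 2`.
Def-free; theorems only. Helper `--supports stmt-Parity-20007`; closes nothing; K_A, K_B and the Parity summit are NOT proved;
nothing about Landau–Siegel zeros.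

## References
* E. Kowalski, P. Michel, J. VanderKam, J. reine angew. Math. 526 (2000), (23)–(28) pp. 13–15 and Prop. 5.1 p. 18
  (the residue evaluation of the diagonal main term; here the log-decorations of a general `Q` in real variables).
  [cite: KowalskiMichelVanderKam2000, (23)–(28) — derivation (prime-square decoration of the Selberg coordinates)]
* T. M. Apostol, *Introduction to Analytic Number Theory*, Springer 1976, Thm 4.9 (Mertens). [cite: Apostol1976, Thm 4.9 — derivation]
-/

noncomputable section

open scoped Real
open Finset ArithmeticFunction

namespace Summit.Parity.GeneralizedHardyLittlewood.Theorems.MomentsBeyondDiagonal.DiagKernel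

open Literature.NumberTheory.LFunctions Literature.NumberTheory.LFunctions.KMV2000
open SelbergCoord (kappa)
open Summit.Parity.GeneralizedHardyLittlewood.Theorems.BeyondDiagonalBeatsQuarter.KernelFormXSq
  (copTauW copTauW_apply_prime mainConst divWeight divWeight_nonneg mainConst_nonneg divWeight_prime_mul_le coprimeSum)


/-! ### Small facts -/

/-- Reindexing the inner sum of `sum_copTauW_mul_mul_sum_primeFactors_eq` as a coprime Selberg sum at `y/p`:
`Σ_{k ≤ ⌊y⌋/p} a_m(k)·logᶜ(y/(pk)) = Σ_{k ≤ y/p} a_m(k)·logᶜ((y/p)/k)`. [folklore] -/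
theorem sum_copTauW_mul_log_div_mul_pow_eq (m c : ℕ) {p : ℕ} (y : ℝ) :
    ∑ k ∈ Icc 1 (⌊y⌋₊ / p), copTauW m k * Real.log (y / ((p * k : ℕ) : ℝ)) ^ c =
      ∑ k ∈ Icc 1 ⌊y / p⌋₊, copTauW m k * Real.log (y / p / k) ^ c := by
  rw [← Nat.floor_div_natCast]
  refine Finset.sum_congr rfl fun k _ ↦ ?_
  rw [Nat.cast_mul, div_div]

/-- For `1 ≤ p ≤ ⌊y⌋`: `0 < p`, `p ≤ y`, `1 ≤ y/p`, `0 ≤ log p ≤ log y`, `0 ≤ log(y/p) ≤ log y`. [folklore] -/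
theorem prime_range_facts {y : ℝ} (hy : 1 ≤ y) {p : ℕ} (hp : p ∈ Icc 1 ⌊y⌋₊) :
    (0 : ℝ) < p ∧ (p : ℝ) ≤ y ∧ 1 ≤ y / p ∧ 0 ≤ Real.log p ∧ Real.log p ≤ Real.log y ∧
      0 ≤ Real.log (y / p) ∧ Real.log (y / p) ≤ Real.log y := by
  have hy0 : 0 < y := by linarith
  have hp' := Finset.mem_Icc.1 hp
  have hp0 : (0 : ℝ) < p := by exact_mod_cast hp'.1
  have hp1 : (1 : ℝ) ≤ p := by exact_mod_cast hp'.1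
  have hpy : (p : ℝ) ≤ y := le_trans (by exact_mod_cast hp'.2) (Nat.floor_le hy0.le)
  have hyp : 1 ≤ y / p := (one_le_div hp0).2 hpy
  have hyp' : y / p ≤ y := div_le_self hy0.le hp1
  exact ⟨hp0, hpy, hyp, Real.log_nonneg hp1, Real.log_le_log hp0 hpy, Real.log_nonneg hyp,
    Real.log_le_log (by positivity) hyp'⟩

/-! ### The prime-sum main part -/

/-- **The prime-sum main part**: for `n ≥ 1`, `y ≥ 1`, `c ≥ 2`,
`|Σ_{p≤y, p∤n}(log p/(p−1))·log p·log^{c−2}(y/p) − logᶜy/(c(c−1))| ≤ 2(19+κ(n))(1+log y)^{c−1}`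
(`log p = log y − log(y/p)`; the weighted Mertens sums of `…DiagPrimeSum` at the orders `c−2` and `c−1`).
[cite: Apostol1976, Thm 4.9 — derivation] -/
theorem abs_sum_primeWeight_log_mul_log_pow_sub_le {n : ℕ} (hn : n ≠ 0) {y : ℝ} (hy : 1 ≤ y) {c : ℕ} (hc : 2 ≤ c) :
    |∑ p ∈ Icc 1 ⌊y⌋₊, (if p.Prime ∧ ¬ p ∣ n then Real.log p / ((p : ℝ) - 1) else 0) *
          (Real.log p * Real.log (y / p) ^ (c - 2)) -
        Real.log y ^ c / ((c : ℝ) * ((c : ℝ) - 1))| ≤ 2 * (19 + kappa n) * (1 + Real.log y) ^ (c - 1) := by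
  obtain ⟨m, rfl⟩ : ∃ m, c = m + 2 := ⟨c - 2, by omega⟩
  have e1 : m + 2 - 2 = m := by omega
  have e2 : m + 2 - 1 = m + 1 := by omega
  rw [e1, e2]
  have hy0 : 0 < y := by linarith
  have hly : 0 ≤ Real.log y := Real.log_nonneg hy
  have hκ : 0 ≤ kappa n := by
    unfold kappa
    exact Finset.sum_nonneg fun p hp ↦ by
      have hp2 : (2 : ℝ) ≤ p := by exact_mod_cast (Nat.prime_of_mem_primeFactors hp).two_le
      exact div_nonneg (Real.log_nonneg (by linarith)) (by linarith)
  obtain ⟨v, hv⟩ : ∃ v : ℕ → ℝ, ∀ p, v p = if p.Prime ∧ ¬ p ∣ n then Real.log p / ((p : ℝ) - 1) else 0 :=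
    ⟨_, fun _ ↦ rfl⟩
  have h1 := abs_sum_primeWeight_coprime_mul_log_pow_sub_le hn hy m
  have h2 := abs_sum_primeWeight_coprime_mul_log_pow_sub_le hn hy (m + 1)
  simp only [← hv] at h1 h2 ⊢
  -- termwise: `log p · L_p^m = log y · L_p^m − L_p^{m+1}`
  have hterm : ∀ p ∈ Icc 1 ⌊y⌋₊, v p * (Real.log p * Real.log (y / p) ^ m) =
      Real.log y * (v p * Real.log (y / p) ^ m) - v p * Real.log (y / p) ^ (m + 1) := by
    intro p hp
    obtain ⟨hp0, -, -⟩ := prime_range_facts hy hp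
    have hlog : Real.log p = Real.log y - Real.log (y / p) := by
      rw [Real.log_div hy0.ne' hp0.ne']; ring
    rw [hlog]; ring
  rw [Finset.sum_congr rfl hterm, Finset.sum_sub_distrib, ← Finset.mul_sum]
  have htarget : Real.log y ^ (m + 2) / (((m + 2 : ℕ) : ℝ) * (((m + 2 : ℕ) : ℝ) - 1)) =
      Real.log y * (Real.log y ^ (m + 1) / ((m : ℝ) + 1)) - Real.log y ^ (m + 1 + 1) / (((m + 1 : ℕ) : ℝ) + 1) := by
    push_cast
    have h1' : (m : ℝ) + 1 ≠ 0 := by positivity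
    have h2' : (m : ℝ) + 2 ≠ 0 := by positivity
    have h3' : (m : ℝ) + 2 - 1 = (m : ℝ) + 1 := by ring
    rw [h3']
    field_simp
    ring
  rw [htarget]
  have hsplit : Real.log y * ∑ p ∈ Icc 1 ⌊y⌋₊, v p * Real.log (y / p) ^ m -
        ∑ p ∈ Icc 1 ⌊y⌋₊, v p * Real.log (y / p) ^ (m + 1) -
      (Real.log y * (Real.log y ^ (m + 1) / ((m : ℝ) + 1)) - Real.log y ^ (m + 1 + 1) / (((m + 1 : ℕ) : ℝ) + 1)) =
      Real.log y * (∑ p ∈ Icc 1 ⌊y⌋₊, v p * Real.log (y / p) ^ m - Real.log y ^ (m + 1) / ((m : ℝ) + 1)) -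
        (∑ p ∈ Icc 1 ⌊y⌋₊, v p * Real.log (y / p) ^ (m + 1) - Real.log y ^ (m + 1 + 1) / (((m + 1 : ℕ) : ℝ) + 1)) := by
    ring
  rw [hsplit]
  calc _ ≤ |Real.log y * (∑ p ∈ Icc 1 ⌊y⌋₊, v p * Real.log (y / p) ^ m - Real.log y ^ (m + 1) / ((m : ℝ) + 1))| +
        |∑ p ∈ Icc 1 ⌊y⌋₊, v p * Real.log (y / p) ^ (m + 1) - Real.log y ^ (m + 1 + 1) / (((m + 1 : ℕ) : ℝ) + 1)| :=
        abs_sub _ _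
    _ ≤ Real.log y * ((19 + kappa n) * (1 + Real.log y) ^ m) + (19 + kappa n) * (1 + Real.log y) ^ (m + 1) := by
        rw [abs_mul, abs_of_nonneg hly]
        exact add_le_add (mul_le_mul_of_nonneg_left h1 hly) h2
    _ ≤ (1 + Real.log y) * ((19 + kappa n) * (1 + Real.log y) ^ m) + (19 + kappa n) * (1 + Real.log y) ^ (m + 1) := by
        have h3 : Real.log y ≤ 1 + Real.log y := by linarith
        have h4 : 0 ≤ (19 + kappa n) * (1 + Real.log y) ^ m := by positivity
        nlinarith [mul_le_mul_of_nonneg_right h3 h4]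
    _ = 2 * (19 + kappa n) * (1 + Real.log y) ^ (m + 1) := by ring

/-! ### Termwise bounds for the prime sum of inner coprime sums -/

/-- Termwise bound, `c ≥ 3`: with `C` the constant of `…DiagCoprime.abs_coprimeSumPow_sub_le`, for `p ≤ y`:
`|[p prime]·log²p·a_n(p)·S⁽ᶜ⁾(y/p;np) + 2c(c−1)E_n·v(p)·log p·log^{c−2}(y/p)| ≤ [p prime, p∤n]·(log p/(p+1))·4C·D(n)(1+log y)^{c−3}log y`
(`v(p) = log p/(p−1)` on primes `p ∤ n`). [cite: KowalskiMichelVanderKam2000, (23)–(28) — derivation] -/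
theorem abs_primeSq_term_sub_le {c : ℕ} {C : ℝ} (hC0 : 0 ≤ C)
    (hC : ∀ n : ℕ, n ≠ 0 → ∀ y : ℝ, 1 ≤ y →
      |∑ k ∈ Icc 1 ⌊y⌋₊, copTauW n k * Real.log (y / k) ^ c -
          (c : ℝ) * ((c : ℝ) - 1) * mainConst n * Real.log y ^ (c - 2)| ≤
        C * divWeight n * (1 + Real.log y) ^ (c - 3))
    {n : ℕ} (hn : n ≠ 0) {y : ℝ} (hy : 1 ≤ y) {p : ℕ} (hp : p ∈ Icc 1 ⌊y⌋₊) :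
    |(if p.Prime then Real.log p ^ 2 * copTauW n p *
          ∑ k ∈ Icc 1 (⌊y⌋₊ / p), copTauW (n * p) k * Real.log (y / ((p * k : ℕ) : ℝ)) ^ c else 0) -
        (-2 * ((c : ℝ) * ((c : ℝ) - 1)) * mainConst n) *
          ((if p.Prime ∧ ¬ p ∣ n then Real.log p / ((p : ℝ) - 1) else 0) *
            (Real.log p * Real.log (y / p) ^ (c - 2)))| ≤
      if p.Prime ∧ ¬ p ∣ n then
        Real.log p / ((p : ℝ) + 1) * (4 * C * divWeight n * (1 + Real.log y) ^ (c - 3) * Real.log y) else 0 := by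
  obtain ⟨hp0, hpy, hyp1, hlp0, hlpy, hL0, hLy⟩ := prime_range_facts hy hp
  have hD := divWeight_nonneg n
  have hly : 0 ≤ Real.log y := Real.log_nonneg hy
  by_cases hpr : p.Prime
  · by_cases hpn : p ∣ n
    · have h0 : copTauW n p = 0 := by rw [copTauW_apply_prime hpr, if_pos hpn]
      have hneg : ¬ (p.Prime ∧ ¬ p ∣ n) := fun h ↦ h.2 hpn
      rw [if_pos hpr, if_neg hneg, if_neg hneg, h0]
      simp
    · have hpos : p.Prime ∧ ¬ p ∣ n := ⟨hpr, hpn⟩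
      rw [if_pos hpr, if_pos hpos, if_pos hpos, copTauW_apply_prime hpr, if_neg hpn,
        sum_copTauW_mul_log_div_mul_pow_eq]
      have hnp : n * p ≠ 0 := mul_ne_zero hn hpr.ne_zero
      have hin := hC (n * p) hnp (y / p) hyp1
      set S := ∑ k ∈ Icc 1 ⌊y / p⌋₊, copTauW (n * p) k * Real.log (y / p / k) ^ c with hS
      set err := S - (c : ℝ) * ((c : ℝ) - 1) * mainConst (n * p) * Real.log (y / p) ^ (c - 2) with herr
      -- the size of the inner error
      have hDnp : divWeight (n * p) ≤ 2 * divWeight n := by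
        rw [mul_comm]; exact divWeight_prime_mul_le hpr hn
      have hpow : (1 + Real.log (y / p)) ^ (c - 3) ≤ (1 + Real.log y) ^ (c - 3) :=
        pow_le_pow_left₀ (by linarith) (by linarith) _
      have herr_le : |err| ≤ 2 * C * divWeight n * (1 + Real.log y) ^ (c - 3) := by
        calc |err| ≤ C * divWeight (n * p) * (1 + Real.log (y / p)) ^ (c - 3) := hin
          _ ≤ C * (2 * divWeight n) * (1 + Real.log y) ^ (c - 3) := by
              gcongr
          _ = 2 * C * divWeight n * (1 + Real.log y) ^ (c - 3) := by ring
      -- the main parts cancel by the prime weight transfer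
      have hE := log_div_succ_mul_mainConst_mul hn hpr hpn
      have hp1 : (p : ℝ) + 1 ≠ 0 := by linarith
      have hSe : S = (c : ℝ) * ((c : ℝ) - 1) * mainConst (n * p) * Real.log (y / p) ^ (c - 2) + err := by
        rw [herr]; ring
      have hkey : Real.log p ^ 2 * (-2 * ((p : ℝ) + 1)⁻¹) * S -
          (-2 * ((c : ℝ) * ((c : ℝ) - 1)) * mainConst n) *
            (Real.log p / ((p : ℝ) - 1) * (Real.log p * Real.log (y / p) ^ (c - 2))) =
          Real.log p ^ 2 * (-2 * ((p : ℝ) + 1)⁻¹) * err := by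
        have hE' : mainConst n * (Real.log p / ((p : ℝ) - 1)) = Real.log p * ((p : ℝ) + 1)⁻¹ * mainConst (n * p) := by
          rw [← hE]; rw [div_eq_mul_inv]
        calc _ = Real.log p ^ 2 * (-2 * ((p : ℝ) + 1)⁻¹) * S +
              2 * ((c : ℝ) * ((c : ℝ) - 1)) * (mainConst n * (Real.log p / ((p : ℝ) - 1))) *
                (Real.log p * Real.log (y / p) ^ (c - 2)) := by ring
          _ = _ := by rw [hE', hSe]; ring
      rw [hkey, abs_mul, abs_mul, abs_of_nonneg (by positivity : (0 : ℝ) ≤ Real.log p ^ 2)]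
      have habs2 : |(-2 : ℝ) * ((p : ℝ) + 1)⁻¹| = 2 * ((p : ℝ) + 1)⁻¹ := by
        rw [abs_mul, abs_inv, abs_of_pos (by linarith : (0 : ℝ) < (p : ℝ) + 1)]
        norm_num
      rw [habs2]
      calc Real.log p ^ 2 * (2 * ((p : ℝ) + 1)⁻¹) * |err|
          ≤ Real.log p ^ 2 * (2 * ((p : ℝ) + 1)⁻¹) * (2 * C * divWeight n * (1 + Real.log y) ^ (c - 3)) :=
            mul_le_mul_of_nonneg_left herr_le (by positivity)
        _ = Real.log p / ((p : ℝ) + 1) * (4 * C * divWeight n * (1 + Real.log y) ^ (c - 3) * Real.log p) := by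
            rw [div_eq_mul_inv]; ring
        _ ≤ Real.log p / ((p : ℝ) + 1) * (4 * C * divWeight n * (1 + Real.log y) ^ (c - 3) * Real.log y) := by
            gcongr
  · have hneg : ¬ (p.Prime ∧ ¬ p ∣ n) := fun h ↦ hpr h.1
    rw [if_neg hpr, if_neg hneg, if_neg hneg]
    simp

/-- Termwise bound, `c = 2`: with `C` the constant of `KernelFormXSqCore.abs_coprimeSum_sub_le`, for `p ≤ y`:
`|[p prime]·log²p·a_n(p)·S⁽²⁾(y/p;np) + 4E_n·v(p)·log p| ≤ [p prime]log p/(p(1+log(y/p))²)·4C·D(n)·log y`.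
[cite: KowalskiMichelVanderKam2000, (23)–(28) — derivation] -/
theorem abs_primeSq_term_two_sub_le {C : ℝ} (hC0 : 0 ≤ C)
    (hC : ∀ n : ℕ, n ≠ 0 → ∀ y : ℝ, 1 ≤ y →
      |coprimeSum n y - 2 * mainConst n| ≤ C * divWeight n / (1 + Real.log y) ^ 2)
    {n : ℕ} (hn : n ≠ 0) {y : ℝ} (hy : 1 ≤ y) {p : ℕ} (hp : p ∈ Icc 1 ⌊y⌋₊) :
    |(if p.Prime then Real.log p ^ 2 * copTauW n p *
          ∑ k ∈ Icc 1 (⌊y⌋₊ / p), copTauW (n * p) k * Real.log (y / ((p * k : ℕ) : ℝ)) ^ 2 else 0) -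
        (-4 * mainConst n) *
          ((if p.Prime ∧ ¬ p ∣ n then Real.log p / ((p : ℝ) - 1) else 0) * Real.log p)| ≤
      (if p.Prime then Real.log p else 0) / ((p : ℝ) * (1 + Real.log (y / p)) ^ 2) *
        (4 * C * divWeight n * Real.log y) := by
  obtain ⟨hp0, hpy, hyp1, hlp0, hlpy, hL0, hLy⟩ := prime_range_facts hy hp
  have hD := divWeight_nonneg n
  have hly : 0 ≤ Real.log y := Real.log_nonneg hy
  by_cases hpr : p.Prime
  · by_cases hpn : p ∣ n
    · have h0 : copTauW n p = 0 := by rw [copTauW_apply_prime hpr, if_pos hpn]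
      have hneg : ¬ (p.Prime ∧ ¬ p ∣ n) := fun h ↦ h.2 hpn
      rw [if_pos hpr, if_neg hneg, if_pos hpr, h0]
      simp only [mul_zero, zero_mul, sub_zero, abs_zero]
      positivity
    · have hpos : p.Prime ∧ ¬ p ∣ n := ⟨hpr, hpn⟩
      rw [if_pos hpr, if_pos hpos, if_pos hpr, copTauW_apply_prime hpr, if_neg hpn,
        sum_copTauW_mul_log_div_mul_pow_eq]
      have hnp : n * p ≠ 0 := mul_ne_zero hn hpr.ne_zero
      have hin := hC (n * p) hnp (y / p) hyp1
      simp only [coprimeSum] at hin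
      set S := ∑ k ∈ Icc 1 ⌊y / p⌋₊, copTauW (n * p) k * Real.log (y / p / k) ^ 2 with hS
      set err := S - 2 * mainConst (n * p) with herr
      have hDnp : divWeight (n * p) ≤ 2 * divWeight n := by
        rw [mul_comm]; exact divWeight_prime_mul_le hpr hn
      have hL1 : 0 < (1 + Real.log (y / p)) ^ 2 := by positivity
      have herr_le : |err| ≤ 2 * C * divWeight n / (1 + Real.log (y / p)) ^ 2 := by
        calc |err| ≤ C * divWeight (n * p) / (1 + Real.log (y / p)) ^ 2 := hin
          _ ≤ C * (2 * divWeight n) / (1 + Real.log (y / p)) ^ 2 := by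
              gcongr
          _ = 2 * C * divWeight n / (1 + Real.log (y / p)) ^ 2 := by ring
      have hE := log_div_succ_mul_mainConst_mul hn hpr hpn
      have hp1 : (p : ℝ) + 1 ≠ 0 := by linarith
      have hSe : S = 2 * mainConst (n * p) + err := by rw [herr]; ring
      have hkey : Real.log p ^ 2 * (-2 * ((p : ℝ) + 1)⁻¹) * S -
          (-4 * mainConst n) * (Real.log p / ((p : ℝ) - 1) * Real.log p) =
          Real.log p ^ 2 * (-2 * ((p : ℝ) + 1)⁻¹) * err := by
        have hE' : mainConst n * (Real.log p / ((p : ℝ) - 1)) = Real.log p * ((p : ℝ) + 1)⁻¹ * mainConst (n * p) := by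
          rw [← hE]; rw [div_eq_mul_inv]
        calc _ = Real.log p ^ 2 * (-2 * ((p : ℝ) + 1)⁻¹) * S +
              4 * (mainConst n * (Real.log p / ((p : ℝ) - 1))) * Real.log p := by ring
          _ = _ := by rw [hE', hSe]; ring
      rw [hkey, abs_mul, abs_mul, abs_of_nonneg (by positivity : (0 : ℝ) ≤ Real.log p ^ 2)]
      have habs2 : |(-2 : ℝ) * ((p : ℝ) + 1)⁻¹| = 2 * ((p : ℝ) + 1)⁻¹ := by
        rw [abs_mul, abs_inv, abs_of_pos (by linarith : (0 : ℝ) < (p : ℝ) + 1)]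
        norm_num
      rw [habs2]
      have hinv : ((p : ℝ) + 1)⁻¹ ≤ ((p : ℝ))⁻¹ := by
        gcongr; linarith
      calc Real.log p ^ 2 * (2 * ((p : ℝ) + 1)⁻¹) * |err|
          ≤ Real.log p ^ 2 * (2 * ((p : ℝ))⁻¹) * (2 * C * divWeight n / (1 + Real.log (y / p)) ^ 2) := by
            gcongr
        _ = Real.log p / ((p : ℝ) * (1 + Real.log (y / p)) ^ 2) * (4 * C * divWeight n * Real.log p) := by
            field_simp
            ring
        _ ≤ Real.log p / ((p : ℝ) * (1 + Real.log (y / p)) ^ 2) * (4 * C * divWeight n * Real.log y) := by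
            gcongr
  · have hneg : ¬ (p.Prime ∧ ¬ p ∣ n) := fun h ↦ hpr h.1
    rw [if_neg hpr, if_neg hneg, if_neg hpr]
    simp

end Summit.Parity.GeneralizedHardyLittlewood.Theorems.MomentsBeyondDiagonal.DiagKernel

end
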